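import Summits.CriticalPhenomena.PercolationContinuityZ3.Theorems.PercNearOneGluingNoHeavyLowerTailSunflowerMultiPetalClutterPendant
import HarnessLib
import HarnessLib.Audit

/-!
# `NoHeavyLowerTail` (crux stmt-CriticalPhenomena-4575), abstract sunflower cubic, `k` petals: the PENCIL-VERTEX CONJECTURE for injectively coloured
# set families (typed, `ClutterPencilVertexK`) and its reduction to ★ₖ for every `MSunflower.ofClutter E`; the contraction of a clutter structure at a
# point is the clutter structure of the ERASED family `i ↦ (E i).erase v`

Support file (seat `prim-l12-p2` gen 35; `--supports stmt-CriticalPhenomena-4575`; companion of `…SunflowerMultiPetalPendant` (p377883) and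
`…SunflowerMultiPetalClutterPendant` (p377908: `MSunflower.ofClutter`)).  No `sorry`.  The `@[conjecture]` definition is an OBLIGATION of the programme (census-true,
unproved), never a fact: use it only as an explicit hypothesis.  Memo: run/shared/lean/prim/prim-l12/prim-l12-p2/FINDING-g35-GRAPH-PENCIL.md §3.

THE PENCIL AT A POINT.  For the clutter structure `F = ofClutter E` of a family `E : Fin k → Finset α`, a window `W` and `v ∈ W`, gen-8's pencil identity reads
`ZKW W = 2·ZKW (W ∖ v) + ZKW_{E/v} (W ∖ v) + X_v`, where `E/v : i ↦ (E i).erase v` is the CONTRACTED family (`ofClutter_contract_ZKW_eq_erase`: the contraction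
`F.contract {v}` and `ofClutter (E/v)` have the same functional on windows avoiding `v`) and `X_v = 2ΣE₁ + ΣE₂` is the exchange sum.  `v` is a PENCIL VERTEX of `W` if
`X_v ≥ 0`, i.e. `2·ZKW (W∖v) + ZKW_{E/v}(W∖v) ≤ ZKW W`.

* `ClutterPencilVertexK` (OPEN, typed conjecture): every nonempty window of every family has a pencil vertex.  CENSUS (memo §3; exact C engines HOME/code-g35/c/pencil*.c,
  clut*.c): GRAPHS (|E i| = 2, injective): all labelled graphs on ≤ 7 vertices (2^21; 14.45 M (graph, vertex) pairs), 1 052 443 connected δ ≥ 2 graphs on 7 vertices,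
  4·10⁴ random / annealed graphs on 8–10 vertices, Monte-Carlo families to 97 vertices: always a pencil vertex (max-degree vertices never fail; only degree-2 vertices fail up to
  n = 7; 'degree ≥ 3 suffices' is FALSE at n = 9); 3-UNIFORM hypergraphs: ALL 1 048 555 families on 6 points (every one of 6.3 M (family, vertex) pairs is pencil), all
  4-uniform on 6 and 5-uniform on 7 points, 10⁴ random (mixed-size, antichain or nested) families on 7–9 points: always a pencil vertex.  Leaves are pencil vertices with
  `X_v = 0` (PROVED: `pencil_of_leaf`, from the pendant identity of p377883).  NOT claimed for non-injective colourings (false: doubled co-star, gen 8).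
* `MSunflower.LeafReducible`, `MSunflower.ZKW_nonneg_of_leafReducible` — ★ₖ UNCONDITIONALLY on every LEAF-REDUCIBLE window (remove isolated points,
  points carrying a singleton edge, or leaves — contracting the leaf's edges); covers all HYPERFORESTS (Berge-acyclic families), extending p377908's forests.
* `partitionLemma_ofClutter_of_pencilVertex` : `ClutterPencilVertexK → ∀ E, 0 ≤ (ofClutter E).ZK` — induction on the window size SIMULTANEOUSLY for all families
  (the contracted family `E/v` has the same index type), base `ZKW ∅ = 0`.  So the conjecture gives ★ₖ for ALL injectively coloured clutters (all graphs and hypergraphs).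
-/

namespace Summit.CriticalPhenomena.PercolationContinuityZ3.Theorems.SunflowerPartition

open Finset

variable {α : Type*} [DecidableEq α] [Fintype α] {k : ℕ}

namespace MSunflower

/-- Labels of two clutter structures agree on two sets containing the same pattern of edges. [this work] -/
theorem ofClutter_lab_eq_of_forall₂ (E E' : Fin k → Finset α) {S T : Finset α} (h : ∀ i, E i ⊆ S ↔ E' i ⊆ T) :
    (ofClutter E).lab S = (ofClutter E').lab T := by
  have hA : S ∈ (ofClutter E).A ↔ T ∈ (ofClutter E').A := by
    rw [mem_ofClutter_A, mem_ofClutter_A]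
    constructor
    · rintro ⟨a, b, hab, ha, hb⟩; exact ⟨a, b, hab, (h a).1 ha, (h b).1 hb⟩
    · rintro ⟨a, b, hab, ha, hb⟩; exact ⟨a, b, hab, (h a).2 ha, (h b).2 hb⟩
  have hV : ∀ i, S ∈ (ofClutter E).V i ↔ T ∈ (ofClutter E').V i := by
    intro i
    rw [mem_ofClutter_V, mem_ofClutter_V, h i]
    rw [mem_ofClutter_A, mem_ofClutter_A] at hA
    rw [hA]
  rcases (ofClutter E).lab_cases S with hS | hS | ⟨i, hSA, hSi, hS⟩
  · rw [((ofClutter E).lab_eq_last_iff S).2 hS, ((ofClutter E').lab_eq_last_iff T).2 (hA.1 hS)]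
  · have hT : (ofClutter E').lab T = 0 := by
      rw [lab_eq_zero_iff] at hS ⊢
      exact ⟨fun hT => hS.1 (hA.2 hT), fun i hT => hS.2 i ((hV i).2 hT)⟩
    rw [hS, hT]
  · rw [hS, (ofClutter E').lab_eq_petalLab (fun hT => hSA (hA.2 hT)) ((hV i).1 hSi)]

omit [Fintype α] in
/-- An edge lies in `insert v X` iff the edge with `v` erased lies in `X`. [this work] -/
theorem subset_insert_iff_erase_subset {e X : Finset α} {v : α} : e ⊆ insert v X ↔ e.erase v ⊆ X := by
  constructor
  · intro h x hx
    rw [mem_erase] at hx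
    have hx' := h hx.2
    rw [mem_insert] at hx'
    rcases hx' with h' | h'
    · exact absurd h' hx.1
    · exact h'
  · intro h x hx
    by_cases hxv : x = v
    · rw [hxv]; exact mem_insert_self v X
    · have : x ∈ X := h (mem_erase.2 ⟨hxv, hx⟩)
      exact mem_insert_of_mem this

/-- **The contraction of a clutter structure at `v` is the clutter structure of the erased family** on windows avoiding `v`:
`((ofClutter E).contract {v}).ZKW U = (ofClutter (fun i => (E i).erase v)).ZKW U` (every window `U`). [this work] -/
theorem ofClutter_contract_ZKW_eq_erase (E : Fin k → Finset α) (v : α) (U : Finset α) :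
    ((ofClutter E).contract {v}).ZKW U = (ofClutter (fun i => (E i).erase v)).ZKW U := by
  rw [(ofClutter E).ZKW_contract_singleton]
  unfold ZKW
  refine nested_congr_of_subset U _ _ fun X S T _ _ _ => ?_
  have key : ∀ Y : Finset α, (ofClutter E).lab (insert v Y) = (ofClutter (fun i => (E i).erase v)).lab Y := fun Y =>
    ofClutter_lab_eq_of_forall₂ E (fun i => (E i).erase v) fun i => subset_insert_iff_erase_subset
  rw [key X, key S, key T]

/-- **Leaves are pencil vertices (with equality)** (this work): if `u ≠ e` lies on every edge through `e` inside `insert e W` (`e ∉ W`), then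
`ZKW (insert e W) = 2·ZKW W + ZKW_{E/e} W`. [pendant identity p377883 + `ofClutter_contract_ZKW_eq_erase`] [this work] -/
theorem pencil_of_leaf (E : Fin k → Finset α) (W : Finset α) (e u : α) (he : e ∉ W) (hue : u ≠ e)
    (hW : ∀ i, e ∈ E i → E i ⊆ insert e W → u ∈ E i) :
    (ofClutter E).ZKW (insert e W) = 2 * (ofClutter E).ZKW W + (ofClutter (fun i => (E i).erase e)).ZKW W := by
  rw [(ofClutter E).ZKW_insert_eq_two_mul_add_contract W e u he (ofClutter_actsThrough E W e u hue hW),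
    ofClutter_contract_ZKW_eq_erase E e W]

/-- **LEAF-REDUCIBLE windows** of a family (this work): `W` is leaf-reducible for `E` if it can be emptied by repeatedly removing (i) a point on no edge
inside the window (isolated), (ii) a point `e` with the singleton edge `{e}` in the family, or (iii) a LEAF `e` — a point such that some `u ≠ e` of the window lies
on every edge through `e` inside the window — where in case (iii) both the restricted window (for `E`) and the CONTRACTED family `E/e : i ↦ (E i).erase e` must
again be leaf-reducible.  Berge-acyclic families of nonempty sets (hyperforests; in particular the edge sets of forests and linear hypertrees) are leaf-reducible
on every window (the incidence forest has a leaf; contracting a leaf vertex keeps it a forest). [this work] -/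
inductive LeafReducible : (Fin k → Finset α) → Finset α → Prop
  | empty (E : Fin k → Finset α) : LeafReducible E ∅
  | isolated (E : Fin k → Finset α) (W : Finset α) (e : α) (he : e ∈ W) (hiso : ∀ i, e ∈ E i → ¬ E i ⊆ W)
      (h : LeafReducible E (W.erase e)) : LeafReducible E W
  | single (E : Fin k → Finset α) (W : Finset α) (e : α) (he : e ∈ W) (i : Fin k) (hi : E i = {e})
      (h : LeafReducible E (W.erase e)) : LeafReducible E W
  | leaf (E : Fin k → Finset α) (W : Finset α) (e u : α) (he : e ∈ W) (hue : u ≠ e)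
      (hthrough : ∀ i, e ∈ E i → E i ⊆ W → u ∈ E i)
      (h₁ : LeafReducible E (W.erase e)) (h₂ : LeafReducible (fun i => (E i).erase e) (W.erase e)) : LeafReducible E W

/-- **★ₖ ON EVERY LEAF-REDUCIBLE WINDOW** (this work; unconditional): `LeafReducible E W → 0 ≤ ZKW W` for the clutter structure of `E`.  Cases: an isolated point is inert
(`ZKW W = 3·ZKW (W∖e)`); a singleton edge makes `{e}` non-bottom, so (MZₖ) at `e` (p343107) gives `ZKW W ≥ ZKW (W∖e)`; at a leaf the pendant identity gives
`ZKW W = 2·ZKW (W∖e) + ZKW_{E/e} (W∖e)` (`pencil_of_leaf`).  Hence ★ₖ for all hyperforests (forests: also `ZK_nonneg_ofClutter_of_leafOrder`, p377908). [this work] -/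
theorem ZKW_nonneg_of_leafReducible {E : Fin k → Finset α} {W : Finset α} (h : LeafReducible E W) : 0 ≤ (ofClutter E).ZKW W := by
  induction h with
  | empty E => rw [(ofClutter E).ZKW_empty]
  | isolated E W e he hiso _ ih =>
    have hWe : insert e (W.erase e) = W := insert_erase he
    have hne : e ∉ W.erase e := notMem_erase e W
    have h3 := (ofClutter E).ZKW_insert_eq_three_mul_of_inert (W.erase e) e hne
      (ofClutter_inert E (W.erase e) e (fun j hj => by rw [hWe]; exact hiso j hj))
    rw [hWe] at h3
    rw [h3]
    linarith
  | single E W e he i hi _ ih =>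
    have hWe : insert e (W.erase e) = W := insert_erase he
    have hlab : (ofClutter E).lab {e} ≠ 0 := by
      intro h0
      rw [lab_eq_zero_iff] at h0
      exact h0.2 i ((mem_ofClutter_V E).2 (Or.inl (hi ▸ subset_refl _)))
    have hmz := (ofClutter E).ZKW_le_ZKW_insert_of_lab_singleton_ne_zero (W.erase e) e (notMem_erase e W) hlab
    rw [hWe] at hmz
    linarith
  | leaf E W e u he hue hthrough _ _ ih₁ ih₂ =>
    have hWe : insert e (W.erase e) = W := insert_erase he
    have hid := pencil_of_leaf E (W.erase e) e u (notMem_erase e W) hue (fun j hj hjW => hthrough j hj (by rw [hWe] at hjW; exact hjW))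
    rw [hWe] at hid
    rw [hid]
    linarith

/-- Whole-type form: a family that is leaf-reducible on the full window satisfies ★ₖ. [this work] -/
theorem ZK_nonneg_of_leafReducible {E : Fin k → Finset α} (h : LeafReducible E univ) : 0 ≤ (ofClutter E).ZK := by
  rw [← (ofClutter E).ZKW_univ]
  exact ZKW_nonneg_of_leafReducible h

end MSunflower

/-- **PENCIL-VERTEX CONJECTURE for injectively coloured set families** (this work; OPEN; census in the file header and memo §3): every nonempty window `W` of every
family `E : Fin k → Finset α` has a point `v ∈ W` with `2·ZKW (W.erase v) + ZKW_{E/v} (W.erase v) ≤ ZKW W` (`E/v : i ↦ (E i).erase v`).  Leaves satisfy it with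
equality (`MSunflower.pencil_of_leaf`).  An obligation, never a fact: use as `(h : ClutterPencilVertexK)`. [status: open] -/
@[conjecture] def ClutterPencilVertexK : Prop :=
  ∀ (k : ℕ) (α : Type) [Fintype α] [DecidableEq α] (E : Fin k → Finset α) (W : Finset α), W.Nonempty →
    ∃ v ∈ W, 2 * (MSunflower.ofClutter E).ZKW (W.erase v) + (MSunflower.ofClutter (fun i => (E i).erase v)).ZKW (W.erase v)
      ≤ (MSunflower.ofClutter E).ZKW W

/-- **Pencil vertices ⟹ ★ₖ for every injectively coloured clutter** (this work): under `ClutterPencilVertexK`, `0 ≤ ZKW W` for every family and every window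
(induction on `#W`, simultaneously for all families with the given index type), in particular `0 ≤ ZK (ofClutter E)`. [this work] -/
theorem ZKW_ofClutter_nonneg_of_pencilVertex (h : ClutterPencilVertexK) {β : Type} [Fintype β] [DecidableEq β] :
    ∀ (n : ℕ) (E : Fin k → Finset β) (W : Finset β), W.card = n → 0 ≤ (MSunflower.ofClutter E).ZKW W := by
  intro n
  induction n using Nat.strong_induction_on with
  | _ n ih =>
    intro E W hW
    by_cases hne : W.Nonempty
    · obtain ⟨v, hvW, hv⟩ := h k β E W hne
      have hlt : (W.erase v).card < n := by rw [← hW]; exact card_erase_lt_of_mem hvW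
      have h1 := ih _ hlt E (W.erase v) rfl
      have h2 := ih _ hlt (fun i => (E i).erase v) (W.erase v) rfl
      linarith
    · rw [not_nonempty_iff_eq_empty.1 hne, (MSunflower.ofClutter E).ZKW_empty]

/-- Whole-type form: **`ClutterPencilVertexK` implies ★ₖ for the clutter structure of every set family** (all graphs, all hypergraphs, injective colourings). [this work] -/
theorem partitionLemma_ofClutter_of_pencilVertex (h : ClutterPencilVertexK) {β : Type} [Fintype β] [DecidableEq β] (E : Fin k → Finset β) :
    0 ≤ (MSunflower.ofClutter E).ZK := by
  rw [← (MSunflower.ofClutter E).ZKW_univ]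
  exact ZKW_ofClutter_nonneg_of_pencilVertex h _ E univ rfl

end Summit.CriticalPhenomena.PercolationContinuityZ3.Theorems.SunflowerPartition
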